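import Mathlib
import HarnessLib
import HarnessLib.Audit
import Summits.PneNP.Statement
import Literature.Computability.MetaComplexity.Frege
import Literature.Computability.MetaComplexity.UniversalMachine
import Literature.Computability.Complexity.Classes
import Literature.Computability.Complexity.CNF
import HarnessLib.Audit.Status.Attr

/-!
Route: FeasibleWitnessing

# Route FeasibleWitnessing — an EF lower bound separates P from NP once SAT algorithms prove their
own errors (Pich–Santhanam, uniform form)

Programme completed: Pich–Santhanam, "Towards P ≠ NP from Extended Frege lower bounds"
(arXiv:2312.08163 = J. ACM 2026,
doi:10.1145/3801091), in its UNIFORM form (arXiv Cor. 2 = JACM Cor. 20). It suffices to show X = X₁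
∧ X₂ where
X₁ (CollapseReachesEF, the authors' Open Problem 1 "prove that any superpolynomial EF lower bound
separates P and NP"): if P = NP
then extended Frege is polynomially bounded — an efficient SAT algorithm would come with short
EF-proofs of every tautology, because
its errors can be feasibly and PROVABLY witnessed (self-provability of upper bounds); and X₂
(EFLowerBound, the Cook–Reckhow 1979 §4
problem, the authors' standing second hypothesis): extended Frege is not polynomially bounded. X₂ is
the item already wanted by routes
ProofCplx / proofcplx (same signature); X₁ is new on this hub. Realises card
self-provability-squeeze-ef-tt in the uniform (Cor. 20)
rather than the nonuniform (Thm 7/8) form.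
Lean: `(¬ PneNP → ∃ F : Literature.Computability.MetaComplexity.FregeSystem,
Literature.Computability.MetaComplexity.IsFrege F ∧ F.IsEFPolyBounded) ∧ (∀ F :
Literature.Computability.MetaComplexity.FregeSystem, Literature.Computability.MetaComplexity.IsFrege
F → ¬ F.IsEFPolyBounded)`

## Assembly
Pure logic (Sketch.lean `assembly_holds`, sorry-free): assume ¬PneNP; CollapseReachesEF gives a
Frege system F with F.IsEFPolyBounded;
EFLowerBound F refutes it. The deciding theorem `closes (hSP : CollapseReachesEF) (hEF :
EFLowerBound) : PneNP` in glue.lean is this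
three-line argument; the assembly item records the same implication and is provable now.
Pich–Santhanam's Cor. 20(2) is the (printed, to-be-formalised) bridge ProvableWitnessing →
CollapseReachesEF inside
crux #2, not part of the glue.

Rationale: WHY THIS LINE. Mechanism (doi:10.1145/3801091 §1.2, Thm 19/Cor. 20; arXiv:2312.08163 §1.1.1, Thm
1/Cor. 2): if a polynomial-time f witnesses,
at every large length n, an error of every ≤ log n-bit n^k-time algorithm that fails to solve
search-SAT at length n, and this is
provable in S¹₂ (equivalently the tautologies w^{k}_n(f) have p-size EF-proofs), then the mere
EXISTENCE of a correct n^{εk}-time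
SAT algorithm A makes EF prove "A solves search-SAT at length n" in polynomial size (substitute A's
code, refute the right disjunct by
evaluation), whence EF refutes ¬φ for every tautology φ by evaluating A(¬φ) — EF is p-bounded;
contrapositively EF-not-p-bounded ⇒
SAT ∉ Time[n^{Ω(k)}] for every k ⇒ P ≠ NP. Imported areas: bounded arithmetic (S¹₂ ↔ EF
correspondence, Cook 1975 / Buss 1986),
refuters / constructive separations (Gutfreund–Shaltiel–Ta-Shma 2007, Bogdanov–Talwar–Wan 2010,
arXiv:2203.14379 — vendored in
Literature.Computability.MetaComplexity.ConstructiveSeparations), and proof complexity of EF. WHY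
NOW (per gap): for X₁ — the hub now
has S¹₂ (BoundedArithTheories/S2Graphs), EF with size-bounded derivation kits
(EFDerives/EFScaffold), universal machines and CJSW
refuters as Lean vocabulary the authors lacked; Chen–Li–Oliveira (ECCC TR24-060, FOCS 2024) and
arXiv:2411.15515 turned "refuter
problems" into objects with a reverse mathematics over PV₁/APC₁; arXiv:2506.16956 (FOCS 2025)
formalised an NP-hardness-of-automatability
argument in PV₁ and pushed it through Cook's translation — the exact pipeline Open Problem 1 needs;
Khaniki–Pich–Sokolov
(doi:10.4230/lipics.ccc.2026.8, Thm 1) isolated "EF-provable anticheckers" (their Condition 2) as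
the operative form of the gap and
proved what it costs. For X₂ — no new lower-bound technology (honest), but the item is SHARED
(stmt-PneNP-10743) and this route doubles
its payoff from "a rung under NP ≠ coNP" to "P ≠ NP outright" (§1.3.2 of the paper). What no listed
route does: every proof-complexity
route here (ProofCplx, proofcplx, ExpanderLinearGenerators, …) climbs the Cook–Reckhow ladder toward
NP ≠ coNP, where EF is NECESSARY;
here EF is SUFFICIENT, the price being a uniform, non-relativizing witnessing theorem about SAT
algorithms. The 2001-archive route
extended-frege-plus-feasible-witnessing (prior programme, not a hub route; target not reached)
pursued the same programme; delta: typed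
crux-only `closes` over the hub's S¹₂/EF/UniversalMachine vocabulary, the witnessing TRUTH layer as
a typed killable support, the
2024–2026 inputs above, and definition requests that make the provability layer typable. The cut S ⇐
(¬S → C) ∧ ¬C with C = "EF
p-bounded" is non-degenerate because ¬S → C is NOT a known collapse consequence (P = NP gives a
p-bounded proof system — the SAT
algorithm's transcript — not EF: arXiv:2312.08163 p. 3 footnote; cf. the band-lemma certificate
Cruxes/RamseyNotNP/WallBreakerCertificate §2 B5).

RANKED CRUXES. #2 CollapseReachesEF (crux) — if P = NP (¬PneNP) then some — equivalently every —
Frege system has polynomially bounded extended Frege proofs: "any superpolynomial EF lower bound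
separates P and NP" (Pich–Santhanam Open Problem 1), to be obtained from S¹₂-provable uniform
witnessing of errors of n^k-time SAT algorithms (Cor. 20(2)) or APC₁-provable anticheckers (§1.3.1;
KPS26 Condition 2). [difficulty: open-problem] (why it might fail: even the TRUTH of same-length
uniform witnessing is open (JACM 12:6 "we do not yet know an unconditional answer"); any proof is
non-relativizing (2001-archive Thm 6.2/6.11: P≠NP oracles where W fails for all f); P=NP may hold
via an algorithm lacking feasible correctness proofs (Cook–Krajíček 2007).) [doi:10.1145/3801091,
arXiv:2312.08163, doi:10.4230/lipics.ccc.2026.8, doi:10.2178/jsl/1203350785, arXiv:2203.14379]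
#3 EFLowerBound (crux) — extended Frege over any Frege system is not polynomially bounded
(Cook–Reckhow 1979 §4; = Literature open statement EFNotPolyBounded unfolded; same signature as
ProofCplx stmt-PneNP-10743 / proofcplx ProofcplxEfLb — intentionally shared). [difficulty:
open-problem] (why it might fail: EF (= propositional S¹₂/PV) may be p-bounded even if P ≠ NP; no
superlinear EF lower bound on any family; feasible interpolation fails for EF under RSA
(Krajíček–Pudlák 1998 Cor. 10 = Barriers.FeasibleInterpolationEF).) [CookReckhow1979,
KrajicekPudlak1998, KrajicekProofComplexity2019, doi:10.1145/3801091]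
#9 UniformWitnessing (support) — TRUTH layer of the witnessing gap (Pich–Santhanam §1.1.1 question;
JACM 12:6 "we do not yet know an unconditional answer"; Cor. 20 with u = 0): for every k and every
efficient universal machine U there is a polynomial-time f such that for all large n and every
program e of ≤ log₂ n bits, either e run n^k steps solves search-SAT on all satisfiable CNF codes of
length n, or f⟨e,1ⁿ⟩ = ⟨x,a⟩ is a certified error of e at length n (|x| = n, a ⊨ x, e outputs no
satisfying assignment of x). Necessary for the S¹₂-provable form; true if P = NP; the cheapest
falsifier target of the line. [difficulty: L] [doi:10.1145/3801091, arXiv:2312.08163,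
arXiv:2203.14379]
#9 SearchSATOfCollapse (support) — search-to-decision under the collapse: if PneNP fails, some
polynomial-time function outputs a satisfying assignment for every satisfiable CNF code (first stub
of the CollapseReachesEF skeleton; standard, Arora–Barak Thm 2.18, with the tree's bridges P_bool_eq
/ NP_bool_eq to Cook's Clay classes). [difficulty: provable-now] [AroraBarakCC2009, CookClay2006]

TWO-LAYER PLAN. Foreseen glued split of CollapseReachesEF (filed later, once vocabulary lands):
CollapseReachesEF ⇐ SearchSATOfCollapse →
SelfProvabilityForSearch → CollapseReachesEF, where SelfProvabilityForSearch := "a polynomial-time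
search-SAT solver makes EF
p-bounded" (birth skeleton stub 2), itself ⇐ ProvableWitnessing (∀k ∃f: S¹₂ ⊢ W^{k,0}(f), the
authors' Open Problem 1 verbatim) →
PSReductionCor20 (Pich–Santhanam Cor. 20(2), printed) → SelfProvabilityForSearch; alternative child
FeasibleAnticheckers (JACM Thm 6 /
§1.3.1 Feasible MinMax; KPS26 Condition 2). EFLowerBound ⇐ FregeLowerBound → LiftFregeToEF →
EFLowerBound (the Cook–Reckhow ladder
cut of its birth skeleton; shared with proofcplx's items). Depth ≤ 1, k ≤ 3 each.

KILL CRITERIA. Refutation of EFLowerBound (a Frege system with p-bounded EF ⇒ NP = coNP) closes this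
route and ProofCplx/proofcplx together
(close --reason refuted:EFLowerBound). CollapseReachesEF cannot be refuted without proving P = NP;
what kills the LINE is a refutation of
the support UniformWitnessing (uniform same-length witnessing false for some k under no hypothesis,
or under a hypothesis weaker than
P ≠ NP) — then pivot crux #2 to the anticheckers child (nonuniform witnessing is unconditionally
true: Lipton–Young) with the payoff
weakened to SAT ∉ SIZE(n^k) per k (JACM Thm 5/6), or retire. NP ≠ coNP proved elsewhere moots the
route (PneNP follows directly).

NOT DECOMPOSED YET. The provability layer (S¹₂ ⊢ W, Cook's translation ‖·‖, EF + axiom schemes) —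
waits for Definition requests D1–D3; the choice between
S¹₂-provable witnessing (Cor. 20(2)) and truth-plus-"EF + w(f) not p-bounded" (Cor. 20(1)); the
advice parameter u(n) (taken 0 here);
the anticheckers / feasible-MinMax child (APC₁); search-to-decision bookkeeping over Mathlib TM2
(support SearchSATOfCollapse).

CHEAPEST FALSIFIER. Lookup (run): is "P = NP ⇒ EF p-bounded" settled? No — it is Pich–Santhanam's
Open Problem 1 (arXiv:2312.08163 §1.2; JACM 2026) and the
2001-archive route's cert-gate verdict was "immune: a covering certificate would refute a.e.
exponential hardness of SAT or need
independence of a true ∀PV sentence" (CLAIMS 2026-08-07). Next cheapest (refuter, this week):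
re-derive the relativized failure of
UniformWitnessing (2001-archive Thm 6.2/6.11 shape: an oracle with P ≠ NP and no p-time a.e.
witnessing) as a Negative lemma over the
tree's `PRel`/`UniversalMachine`, fixing that crux #2 admits no relativizing proof; and test
UniformWitnessing for k = 1 against the
explicit family "e_c = output the all-c assignment" (must be witnessed by one FP function uniformly
in c — a sanity instance, in-Lean).

NUMBERS. Witnessing parameters as printed: programs of ≤ log₂ n description bits, n^k steps, advice
u(n) ≤ n^k (here u = 0), conclusion
SAT ∉ Time[n^{εk}]/u(n) with ε > 0 universal (JACM Cor. 20); anticheckers sets of size poly(n^k)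
(Lipton–Young; JACM Thm 5, k ≥ 3).
Known EF lower bounds: none superlinear (KrajicekProofComplexity2019 §22.3). Items at open: 5 (2
crux, 2 support, 1 assembly).

DEFINITION REQUESTS. D1 CookTranslation (topic Literature/Computability/MetaComplexity): Cook's
propositional translation ‖φ‖ⁿ of Π^b_1 formulas of
`FirstOrder.Language.boundedArith` into `PropForm ℕ` families with bit variables, plus the named
fact "S¹₂ ⊢ ∀x φ(x), φ ∈ Π^b_1 ⇒
‖φ‖ⁿ have poly(n)-size EF-proofs" (Cook 1975; Buss 1986 Ch. 9; Krajíček 1995 §9.2). D2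
BussSatFormula: a Δ^b_1(S¹₂) bounded formula
SAT(x,y) of Buss's language defining "y satisfies the CNF coded by x" compatibly with G01
`encodingCNF` (via `seqel`). D3 ClockedRunGDef:
a `GDef` (Σ^b_1, `Good` in S¹₂) for the clocked run (e, x, 1^t) ↦ U.run (boolPair e x) t of a fixed
efficient universal machine.
With D1–D3 the informal items ProvableWitnessing and PSReductionCor20 (filed after open) receive
signatures. Cite fact wanted:
Pich–Santhanam Cor. 20 (doi:10.1145/3801091) as
`Literature.Computability.MetaComplexity.pichSanthanam_cor20`.

Novelty: Searches (2026-08-17): `lit search --hybrid "self-provability circuit upper bounds Extended Frege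
witnessing"` (12 book hits, none on the mechanism); `lit citing arxiv:2312.08163` (4:
arXiv:2506.16956, arXiv:2405.02232, Khaniki FOCS24, corpus) and `lit citing doi:10.1145/3801091
--source api` (4: doi:10.4230/lipics.ccc.2026.8, arXiv:2504.04416, arXiv:2411.15515); `lit galaxy
search "feasible witnessing" --star all` (1 irrelevant hit); `lit read doi:10.1145/3801091` pp
12:3–7, 12:10–12, 12:21–22; `lit read arxiv:2312.08163` pp 2–7; `lit read
doi:10.4230/lipics.ccc.2026.8` pp 1–5; `lean search 'EFNotPolyBounded|¬ PneNP →'` (57 hits; no decl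
of shape ¬PneNP → EF p-bounded); hosting_routes.jsonl (48 routes: none uses
witnessing/self-provability); idea cards grep (self-provability-squeeze-ef-tt, graded known); 2001
archive SURVEY C15/B12/D1(i)/D9 + routes/extended-frege-plus-feasible-witnessing brief+CLAIMS.
Nearest prior art found: doi:10.1145/3801091 / arXiv:2312.08163 (the programme itself: Cor. 20, Open
Problems 1–2); 2001-archive route extended-frege-plus-feasible-witnessing (same programme, prior
hub; oracle Thms 6.2/6.5/6.11, Thm A; target not reached); card self-provability-squeeze-ef-tt
(nonuniform Thm 7/8 squeeze); route ProofCplx (shares EFLowerBound only).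
Delta: a faithful hosting of a published programme (lens program-completion): the uniform Cor. 20
cut typed as two load-bearing cruxes over the hub's Frege/EF vocabulary with pure-logic `closes`,
the witnessing truth  [refs: 10.1145/3801091, 10.4230/lipics.ccc.2026.8, 10.1145/3801091`, 10.4230/lipics.ccc.2026.8`, 2312.08163, 2506.16956, 2405.02232, 2504.04416, 2411.15515, arxiv:2312.08163, doi:10.1145/3801091, doi:10.4230/lipics.ccc.2026.8]

Barriers (technique_class: feasible-witnessing, self-provability, ef-lower-bounds): - technique_class: feasible-witnessing, self-provability, ef-lower-bounds
- Literature.Barriers.PneNP.Relativization: bites crux #2 — the 2001-archive oracles (Thm 6.2: P^O ≠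
NP^O with W(f) false for all f; Thm 6.11: no n^k circuits for search-SAT and no p-time a.e.
witnessing) show UniformWitnessing and hence any witnessing proof of CollapseReachesEF must be
non-relativizing; the mechanism is: EF-provability of the correctness of a concrete f and
substitution of a concrete algorithm's code are not oracle-invariant statements (escaping
hypothesis: "S¹₂ ⊢ W(f)").
- Literature.Barriers.PneNP.BoundedRelativization: same reading; the glue is logic and needs no
evasion; the PSPACE-oracle collapse makes ¬S true and says nothing about EF.
- Literature.Barriers.PneNP.Algebrization: as Relativization (2001-archive Cor. 6.6(b): algebrizing
proofs of W excluded); escaping hypothesis again the provability of a white-box statement about f.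
- Literature.Barriers.PneNP.NaturalProofs: does not apply — no property of truth tables is used and
the conclusion is uniform (P ≠ NP, not NP ⊄ P/poly); Pich–Santhanam Prop. 1 (a generic "R not
p-bounded ⇒ NP ⊄ P/poly" forces NP ⊄ SIZE[n^ℓ]) is evaded by the uniform/advice-free form (JACM
12:3, "Third" possibility).
- Literature.Barriers.PneNP.FeasibleInterpolationEF: it does; the bet is the shared crux #3 — EF
lower bounds cannot come from interpolation under RSA (KrajicekPudlak1998 Cor. 10); candidate
mechanisms are Krajíček/Razborov generator hardnes

History (route lifecycle, newest last):
- 2026-08-17T01:50:57Z · rev 1: restated Assembly (stmt-PneNP-17357) — restate Assembly: rev-0 frame was tauto-trivial (ground.trivial); new frame routes through the G01 classes and needs the Clay bridges (provable-now, checked) (planner-plan-lens3-PneNP-complete-0)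
- 2026-08-24T21:41:09Z · DORMANT — reconciler: no traction for 7.1 d (last activity statement-attached at 2026-08-17T18:50:05Z); parked, not closed — `ledger route dormant route-PneNP-FeasibleWit (operator:999:728398)
- 2026-08-27T15:40:50Z · REACTIVATED — reconciler: reactivated — activity statement-claimed at 2026-08-27T13:02:52Z after parking at 2026-08-24T21:41:09Z (operator:999:3742968)

sub-problem: PneNP · status: open · opened planner-plan-lens3-PneNP-complete-0 2026-08-17T01:49:08Z · rev 1 · ledger route-PneNP-FeasibleWitnessing
GENERATED by the gate from the ledger (D-0016/17). Provers cite these decls: `theorem foo : Summit.PneNP.PneNP.Theses.FeasibleWitnessing.<Decl> := …` in Summits/PneNP/PneNP/Theorems/<Name>.lean.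
-/

namespace Summit.PneNP.PneNP.Theses.FeasibleWitnessing

open scoped BigOperators Topology Manifold Classical MeasureTheory ProbabilityTheory Matrix InnerProductSpace ComplexConjugate ContinuousMap
open Filter Set Function TopologicalSpace MeasureTheory

attribute [summit_statement] _root_.PneNP

open Literature.PNP

/-- item stmt-PneNP-17354 · crux · rank 2 · open · by planner
why it might fail: even the TRUTH of same-length uniform witnessing is open (JACM 12:6 "we do not yet know an unconditional answer"); any proof is non-relativizing (2001-archive Thm 6.2/6.11: P≠NP oracles where W fails for all f); P=NP may hold via an algorithm lacking feasible correctness proofs (Cook–Krajíček 2007).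
sources: doi:10.1145/3801091, arXiv:2312.08163, doi:10.4230/lipics.ccc.2026.8, doi:10.2178/jsl/1203350785, arXiv:2203.14379
[crux] if P = NP (¬PneNP) then some — equivalently every — Frege system has polynomially bounded
extended Frege proofs: "any superpolynomial EF lower bound separates P and NP" (Pich–Santhanam Open
Problem 1), to be obtained from S¹₂-provable uniform witnessing of errors of n^k-time SAT algorithms
(Cor. 20(2)) or APC₁-provable anticheckers (§1.3.1; KPS26 Condition 2). [difficulty: open-problem] -/
@[route_item "route-PneNP-FeasibleWitnessing", crux]
def CollapseReachesEF : Prop :=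
  ¬ PneNP → ∃ F : Literature.Computability.MetaComplexity.FregeSystem, Literature.Computability.MetaComplexity.IsFrege F ∧ F.IsEFPolyBounded

/-- item stmt-PneNP-10743 · crux · rank 3 · open · by planner
why it might fail: EF (= propositional S¹₂/PV) may be p-bounded even if P ≠ NP; no superlinear EF lower bound on any family; feasible interpolation fails for EF under RSA (Krajíček–Pudlák 1998 Cor. 10 = Barriers.FeasibleInterpolationEF).
sources: CookReckhow1979, KrajicekPudlak1998, KrajicekProofComplexity2019, doi:10.1145/3801091
[crux] pnp.S32 stated directly: for every Frege system F (finitely many sound rules, implicationally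
complete), extended Frege over F is not polynomially bounded — no polynomial p gives every tautology
φ an EF-proof of symbol size ≤ p(φ.size). This is verbatim the definiens of the Literature open
statement `Literature.Computability.Complexity.EFNotPolyBounded` (ProofComplexity.lean; the item is
`Iff.rfl`-equal to it, so theorem `not_isPolyBounded_of_efNotPolyBounded` (#3 → #2) and fact
`efNotPolyBounded_iff_textbookFrege` (reduce to textbookFrege) transfer by `Iff.rfl`); restated
inline (route-repair 2026-08-15) so that the route's cone carries the open conjecture as a ROUTE
ITEM and not as an undischarged Literature Prop (D-0023 staffability; conjectures live in routes).
Open (CookReckhow1979 §4). Equivalent to unprovability of NP = coNP-type statements in S¹₂/PV via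
propositional translation (Cook 1975; Buss1998) — where bounded arithmetic / forcing enters.
Grounder/refuter verdicts on the replaced item stmt-PneNP-0044 (NEW/OPEN, 2026-08-13) apply
unchanged. [deps: ProofcplxFregeLb] [difficulty: open-problem] -/
@[route_item "route-PneNP-FeasibleWitnessing", crux (bottleneck := idea) (source := "director FRONTIER l.123, 2026-09-01")]
def EFLowerBound : Prop :=
  ∀ F : Literature.Computability.MetaComplexity.FregeSystem, Literature.Computability.MetaComplexity.IsFrege F → ¬ F.IsEFPolyBounded

/-- item stmt-PneNP-17355 · support · rank 9 · open · by planner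
sources: doi:10.1145/3801091, arXiv:2312.08163, arXiv:2203.14379
[support] TRUTH layer of the witnessing gap (Pich–Santhanam §1.1.1 question; JACM 12:6 "we do not
yet know an unconditional answer"; Cor. 20 with u = 0): for every k and every efficient universal
machine U there is a polynomial-time f such that for all large n and every program e of ≤ log₂ n
bits, either e run n^k steps solves search-SAT on all satisfiable CNF codes of length n, or f⟨e,1ⁿ⟩
= ⟨x,a⟩ is a certified error of e at length n (|x| = n, a ⊨ x, e outputs no satisfying assignment of
x). Necessary for the S¹₂-provable form; true if P = NP; the cheapest falsifier target of the line.
[difficulty: L] -/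
@[route_item "route-PneNP-FeasibleWitnessing"]
def UniformWitnessing : Prop :=
  ∀ k : ℕ, ∀ U : Literature.Computability.MetaComplexity.UniversalMachine, ∃ f : List Bool → List Bool, f ∈ Literature.Computability.Complexity.FP ∧ ∃ n₀ : ℕ, ∀ n ≥ n₀, ∀ e : List Bool, e.length ≤ Nat.log2 n → (∀ x : List Bool, x.length = n → (∃ (y : List Bool) (φ : Literature.Computability.Complexity.CNF ℕ), Literature.Computability.Complexity.encodingCNF.decode x = some φ ∧ φ.eval (fun i => y.getD i false) = true) → ∃ (y : List Bool) (φ : Literature.Computability.Complexity.CNF ℕ), U.run (Literature.Computability.Complexity.boolPair e x) (n ^ k) = some y ∧ Literature.Computability.Complexity.encodingCNF.decode x = some φ ∧ φ.eval (fun i => y.getD i false) = true) ∨ (∃ (x a : List Bool) (φ : Literature.Computability.Complexity.CNF ℕ), Literature.Computability.Complexity.boolUnpair (f (Literature.Computability.Complexity.boolPair e (Computability.unaryEncodeNat n))) = (x, a) ∧ x.length = n ∧ Literature.Computability.Complexity.encodingCNF.decode x = some φ ∧ φ.eval (fun i => a.getD i false) = true ∧ ∀ y : List Bool, U.run (Literature.Computability.Complexity.boolPair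 e x) (n ^ k) = some y → φ.eval (fun i => y.getD i false) = false)

/-- item stmt-PneNP-17356 · support · rank 9 · open · by planner
sources: AroraBarakCC2009, CookClay2006
[support] search-to-decision under the collapse: if PneNP fails, some polynomial-time function
outputs a satisfying assignment for every satisfiable CNF code (first stub of the CollapseReachesEF
skeleton; standard, Arora–Barak Thm 2.18, with the tree's bridges P_bool_eq / NP_bool_eq to Cook's
Clay classes). [difficulty: provable-now] -/
@[route_item "route-PneNP-FeasibleWitnessing"]
def SearchSATOfCollapse : Prop :=
  ¬ PneNP → ∃ g : List Bool → List Bool, g ∈ Literature.Computability.Complexity.FP ∧ ∀ (x : List Bool) (φ : Literature.Computability.Complexity.CNF ℕ), Literature.Computability.Complexity.encodingCNF.decode x = some φ → φ.Satisfiable → φ.eval (fun i => (g x).getD i false) = true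

-- item stmt-PneNP-17365 · support · rank 9 · open · by planner — informal only, no Lean statement yet:
--   [support; layer-2 child of CollapseReachesEF — the author-named gap VERBATIM] Pich–Santhanam Open
--   Problem 1 (arXiv:2312.08163 §1.2; JACM doi:10.1145/3801091 Cor. 20(2) with u = 0): for every k ≥ 1
--   there are a polynomial-time f and n₀ such that S¹₂ ⊢ W^{k,0}_{n₀}(f) — the ∀Π^b_1 sentence "for all
--   n > n₀ and every ≤ log n-bit program e run n^k steps: either e solves search-SAT on all satisfiable
--   CNF codes of length n, or f(e,1ⁿ) = (x,a) with |x| = n, a ⊨ x and e(x) ⊭ x" (equivalently: the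
--   propositional translations w^{k,0}_n(f) have poly(n)-size EF-proofs). Truth shadow = item
--   UniformWitnessing.

-- item stmt-PneNP-17372 · support · rank 9 · open · by planner — informal only, no Lean statement yet:
--   [support; printed theorem — the programme reduction] Pich–Santhanam, J. ACM 2026
--   doi:10.1145/3801091, Corollary 20(2) (= arXiv:2312.08163 Cor. 2(2)), proof via Thm 19 (12:21–22):
--   for k ≥ 1 and p-time u ≤ n^k, if S¹₂ ⊢ W^{k,u}_{n₀}(f) for some p-time f and n₀, and EF is not
--   p-bounded, then SAT ∉ Time[n^{εk}]/u(n) (ε > 0 universal). In this route: ProvableWitnessing →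
--   SearchSATOfCollapse-type bookkeeping → CollapseReachesEF (indeed "a polynomial-time search-SAT
--   solver makes EF p-bounded", birth-skeleton stub 2). To be vendored as the named fact
--   Literature.Computability.MetaComplexity.pichSanthan

-- item stmt-PneNP-17373 · support · rank 9 · open · by planner — informal only, no Lean statement yet:
--   [support; alternative child of CollapseReachesEF, nonuniform payoff] Pich–Santhanam JACM Thm 6
--   (arXiv Thm 3, "CC ← PC from feasible anticheckers") and §1.3.1 "Feasible MinMax": if for k ≥ 3 a
--   p-time f S¹₂-provably outputs on 1ⁿ either a poly(n^k)-size circuit solving search-SAT_n or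
--   anticheckers sets A^{SAT_n,n^k}_n with certified assignments, then EF not p-bounded ⇒ SAT_n ∉
--   Circuit[n^k] i.o. (for all k: NP ⊄ SIZE[n^ℓ] ∀ℓ). Operative 2026 form: Khaniki–Pich–Sokolov CCC 2026
--   doi:10.4230/lipics.ccc.2026.8 Condition 2 ("EF proves efficiently: a small circuit solving SAT on
--   the anticheckers set A

-- earlier Assembly (stmt-PneNP-17357, replaced 2026-08-17T01:50:57Z -> stmt-PneNP-17359): retired by None — (¬ PneNP → ∃ F : Literature.Computability.MetaComplexity.FregeSystem, Literature.Computability.MetaComplexity.IsFrege F ∧ F.IsEFPolyBounded) → (∀ F : Literature.Computability.MetaComplexity.FregeSystem, Literature.Computability.MetaComplexity.IsFrege F → ¬ F.IsEFPolyBounded) → PneNP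
/-- item stmt-PneNP-17359 · assembly · rank 1 · open · by planner
sources: doi:10.1145/3801091, CookReckhow1979
[assembly] frame over the tree working classes: (NP ⊆ P over Classes.P / Nondeterministic.NP ⇒ EF
p-bounded) → EFLowerBound → PneNP. Provable now (planner AssemblyRestate.lean rc0: by_contra + Clay
bridges P_bool_eq_holds / NP_bool_eq_holds), NOT tauto-trivial (ground check). Its first hypothesis
is the working-class form of crux CollapseReachesEF (equivalent via the bridges), which is the form
provers of #2 will use. -/
@[route_item "route-PneNP-FeasibleWitnessing"]
def Assembly : Prop :=
  (Literature.Computability.Complexity.Nondeterministic.NP ⊆ Literature.Computability.Complexity.Classes.P → ∃ F : Literature.Computability.MetaComplexity.FregeSystem, Literature.Computability.MetaComplexity.IsFrege F ∧ F.IsEFPolyBounded) → (∀ F : Literature.Computability.MetaComplexity.FregeSystem, Literature.Computability.MetaComplexity.IsFrege F → ¬ F.IsEFPolyBounded) → PneNP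

/-! D-0027 §2.1 — DECIDING THEOREM (planner-authored via `route open/edit --closes-file`; by planner-plan-lens3-PneNP-complete-0 2026-08-17T01:49:08Z):
its hypotheses are this route's items and its conclusion the sub-problem Statement (glue_lint), and it elaborates with this file. -/

@[closes "route-PneNP-FeasibleWitnessing"] theorem closes (hSP : CollapseReachesEF) (hEF : EFLowerBound) : PneNP := by
  by_contra hS
  obtain ⟨F, hF, hb⟩ := hSP hS
  exact hEF F hF hb

end Summit.PneNP.PneNP.Theses.FeasibleWitnessing
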